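/-
Copyright: statement-level skeleton of a published paper (lit-balaban cell, Phase-2 proof seat p13, gen 11). No proof
claims beyond what the kernel checks below.
-/
import Literature.MathematicalPhysics.QuantumFieldTheory.BalabanImbrieJaffe1984to88.BIJ88TraceTermsBound579

/-!
# `BalabanImbrieJaffe1984to88.BIJ88SmallLetterRemainders293` — T. Bałaban, J. Imbrie, A. Jaffe, *Effective action and
cluster properties of the abelian Higgs model*, Commun. Math. Phys. **114** (1988) 257–315 [BalabanImbrieJaffe1988]:
Sect. 5.7, pp. 292–295 — THE REMAINDERS OF THE RESUMMATION, `W^{(j)‴}`, `W^{(j)(iv)}`, `W^{(j)(v)}` (and `W^{(k)(vi)}`): terms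
with AT LEAST ONE SMALL LETTER are small, with the decay in `|X|`.

## The print (verbatim; pp. 292–295 [PDF 36–39])

p. 292/293: *"Using the random walk expansions we can write the difference as Σ_X C^{(j)′}(X), with |C^{(j)′}(X,x₁,x₂)| ≦
e^{−c|x₁−x₂|}e^{−cr(e_k)|X|} … Terms with all C^{(j)}_{B_{m−j}(Λ^{(m)})}(u_{k+1})'s will be considered below. In all other terms, we
random-walk expand any C^{(j)}_{B_{m−j}(Λ^{(m)})}(u_{k+1})'s, sum over m, and obtain Σ_X W^{(j)‴}(X), with |W^{(j)‴}(X)| ≦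
e^{−cr(e_j)|X|}."*  p. 293: *"In the leading terms (terms with no e^{−cr(e_j)} from the random walk expansions) we put ζ″_j =
1 + (ζ″_j − 1). … Remainder terms are again localized … We gather all terms of this rather complicated expansion of the
remainders and sum over m, to yield Σ_X W^{(j)(iv)}(X), with |W^{(j)(iv)}(X)| ≦ e^{−cr(e_j)|X|}."*  p. 294: *"All remainder terms
have at least one operator C^{(j)″}(X), which provides exponential localization to B_{m−j}(Λ₃^{(m)})^c. The field Ã_m is
supported in Λ̄₅^{(m)}, thus all terms have at least a factor e^{−cr(e_j)}. Thus we can sum all the remainder terms into Σ_X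
W^{(j)(v)}(X), with |W^{(j)(v)}(X)| ≦ e^{−cr(e_j)|X|}."*  p. 295 (m = k): *"The remainder terms become Σ_X W^{(k)(vi)}(X), with
|W^{(k)(vi)}(X)| ≦ e^{−cr(e_k)|X|}."*  p. 294: *"As always, X is a connected union of L^{k−j}r(e_k)-cubes"*.

THE COMMON MECHANISM: each remainder term contains at least one SMALL letter — a piece `C^{(j)′}(X)`, `Δ_j(X)` or `C^{(j)″}(X)`
of a random walk expansion, carrying *"at least a factor e^{−cr(e_j)}"* (their bounds: (5.7.11) and the p. 292/p. 294 displays,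
PROVED as model instances in `BIJ88DirichletReplacement292`, `BIJ88Delta5711`, `BIJ88NoDirichlet294`) — whence the whole
term, and the sum of the terms with hull `X`, is small with the decay `e^{−cr(e_j)|X|}`.

statement-level skeleton of published theorems with citation tags; proofs where landed; nothing here is a claim about the Yang–Mills mass gap

PDF held: `paper:balaban1988-cmp114-bij-abelian-higgs-effective-action` (journal page = PDF page + 256); pp. 292–294
[PDF 36–38] read as IMAGES (CCITT renders; copies `HOME/lit-balaban-p13/pages/original-p036-x2.png` … `-p038-x2.png`).

CITATION HEADER (lean-in-tree rule).  Part of the lit-balaban TYPED SKELETON (HOME `run/shared/lean/pub/lit-balaban/`):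
WHAT IS REPRODUCED = row **C2.Eq5.7.10-5.7.12** of `HOME/lit-balaban-r16/ROWS-C2-part2.md` (E-row, pp. 291–294), members
*the `W^{(j)‴}`, `W^{(j)(iv)}`, `W^{(j)(v)}` bounds* (and the p. 295 `W^{(k)(vi)}` bound, same shape), their common printed
mechanism.  Unit `lit-balaban-p13` (gen 11), owner r16, referee ref-5.  Built BY NAME on the gen-8 word/letter model of the
(5.7.4) trace terms — `BIJ88TraceTerms579` (`letter`, `hull`, `LinkedFrom`, `cube_mem_hull_of_bprod_apply_ne_zero`, `wlen`,
`Wprime`, `cubePolymers`) and `BIJ88TraceTermsBound579` (`norm_bprod_le`, `abs_wlen_le_of_majorant`, `sum_hull_linkedFrom_le`);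
it GENERALIZES gen 8's `BIJ88Ineq579First.abs_wlen_le_graded` (there every `W`-letter has degree `≥ 1`; here both letter
families are graded with degrees `≥ 0` and only the selected total degree matters); nothing restated.

## The typing (model instance, READING declared — the gen-8 model plus a GRADING of both letter families)

As in `BIJ88TraceTerms579`: sites `T`, cubes `ι`, `cube : T → ι`, letters `C_a`, `W_b` with cube supports, words, `wlen`,
`W(X) = Σ_{l≥1}(1/2l)·wlen l S_l X` (`Wprime`).  NEW: degrees `degC a, degW b ∈ ℕ` counting the SMALL FACTORS a letter carries,
`‖C_a‖ ≤ ε^{degC a}·c_a`, `‖W_b‖ ≤ ε^{degW b}·w_b` (`0 ≤ ε ≤ 1`; print: `ε = e^{−cr(e_j)}`, degree `1` for the pieces `C′(X)`,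
`Δ_j(X)`, `C″(X)`, `0` for the others), and a selection keeping words of total degree `≥ m` (print: `m = 1`, *"at least one"*).

## What is kernel-checked here

* §1 **`abs_wlen_le_biGraded`** — for every such selection, every cube set `X`, every `κ ≥ 0`:
  `|wlen (l+1) S X| ≤ s·|X|·ε^m·e^{−κ|X|}·(N_c N_w)^{l+1}` (`s` sites per cube, `N_c`, `N_w` the `κ`-weighted rooted sums of the
  weights `c_a`, `w_b`): one free summation as in (5.7.9), the small factors collected from the graded letters.
* §2 **`abs_Wprime_le_biGraded`** — the length series converges for `N_c N_w < 1` and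
  `|W(X)| ≤ ε^m·(N_c N_w/(2(1 − N_c N_w)))·s·|X|·e^{−κ|X|}`.
* §3 **`abs_Wprime_le_printed_remainder`** — THE PRINTED SHAPE `|W(X)| ≤ e^{−cr(e_j)|X|}` on the cube polymer system
  (`cubePolymers`, `|X|` = number of cubes) for `m = 1`, `ε = e^{−cr(e_j)}`-type small factor and decay rate `κ ≥ cr(e_j) + 1`,
  under the constants hypothesis `ε·s·N_cN_w/(2(1−N_cN_w)) ≤ 1` (the one small factor absorbs the volume of a cube and the
  series constant; `|X|e^{−|X|} ≤ 1` absorbs the free `|X|`) — generic-constant reading as in G-C2-p36-03; this is the (S3)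
  shape `|D_j(X)| ≤ n_D e^{−cr(e_j)|X|}` consumed by p36's knitting `BIJ88Ineq5714Proof.ineq5714_knit`.

HONEST SCOPE.  Letters, supports, degrees, weights and rooted sums are INPUTS in the displayed shapes (which pieces carry the
factor `e^{−cr(e_j)}` — the instance's reading of pp. 292–294 — is the grading; nothing of the *"rather complicated expansion"*
is constructed); the words are the trace terms of (5.7.4) as modelled in gen 8 (the low-order terms of (5.7.10) are among
them, p. 291).  Theorems only; no definitions, no `Prop` facts; axioms standard.
-/

namespace Literature.MathematicalPhysics.QuantumFieldTheory.BalabanImbrieJaffe1984to88.BIJ88SmallLetterRemainders293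

open Finset
open Literature.MathematicalPhysics.QuantumFieldTheory.Balaban1983to89.B4RandomWalk213 (bprod)
open BIJ88TraceTerms579 BIJ88TraceTermsBound579
open scoped Matrix Matrix.Norms.Operator

variable {T ι A B : Type*} [Fintype T] [DecidableEq T] [Fintype ι] [DecidableEq ι]
  [Fintype A] [DecidableEq A] [Fintype B] [DecidableEq B]

/-! ## §1 Words of total degree `≥ m`: the small factors collected -/

section Graded

variable {cube : T → ι} {Cl : A → Matrix T T ℝ} {sC : A → Finset ι} {Wl : B → Matrix T T ℝ} {sW : B → Finset ι}

omit [Fintype ι] [DecidableEq A] [DecidableEq B] in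
/-- **AT LEAST ONE SMALL LETTER** — *"all terms have at least a factor e^{−cr(e_j)} … |W^{(j)(v)}(X)| ≦ e^{−cr(e_j)|X|}"*: grade
both letter families by the number of small factors they carry, `‖C_a‖ ≤ ε^{degC a}·c_a`, `‖W_b‖ ≤ ε^{degW b}·w_b` (`0 ≤ ε ≤ 1`,
degrees `≥ 0`), and select words of total degree `≥ m`; then for every cube set `X` and `κ ≥ 0`:
`|wlen (l+1) S X| ≤ s·|X|·ε^m·e^{−κ|X|}·(N_c N_w)^{l+1}` — gen 8's one free summation (`abs_wlen_le_of_majorant`) with the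
majorant `ε^m·Π c_{a_i}w_{b_i}` and the rooted linked-chain sum (`sum_hull_linkedFrom_le`).
[cite: BalabanImbrieJaffe1988, p.293, p.294] -/
theorem abs_wlen_le_biGraded
    (hCs : ∀ a x y, Cl a x y ≠ 0 → cube x ∈ sC a ∧ cube y ∈ sC a)
    (hWs : ∀ b x y, Wl b x y ≠ 0 → cube x ∈ sW b ∧ cube y ∈ sW b)
    {s : ℕ} (hs : ∀ c : ι, (Finset.univ.filter fun x => cube x = c).card ≤ s)
    {κ : ℝ} (hκ : 0 ≤ κ) (degC : A → ℕ) (degW : B → ℕ) {ε : ℝ} (hε0 : 0 ≤ ε) (hε1 : ε ≤ 1)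
    (cA : A → ℝ) (hcA : ∀ a, 0 ≤ cA a) (hCle : ∀ a, ‖Cl a‖ ≤ ε ^ degC a * cA a)
    (wB : B → ℝ) (hwB : ∀ b, 0 ≤ wB b) (hWle : ∀ b, ‖Wl b‖ ≤ ε ^ degW b * wB b) {Nc Nw : ℝ}
    (hNc : ∀ c : ι, ∑ a, (if c ∈ sC a then cA a * Real.exp (κ * (sC a).card) * (sC a).card else 0) ≤ Nc)
    (hNw : ∀ c : ι, ∑ b, (if c ∈ sW b then wB b * Real.exp (κ * (sW b).card) * (sW b).card else 0) ≤ Nw)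
    (l : ℕ) (S : (Fin (l + 1) → A × B) → Prop) [DecidablePred S] {m : ℕ}
    (hS : ∀ w, S w → m ≤ ∑ i, (degC (w i).1 + degW (w i).2)) (X : Finset ι) :
    |wlen Cl sC Wl sW (l + 1) S X| ≤
      s * X.card * (ε ^ m * (Real.exp (-(κ * X.card)) * (Nc * Nw) ^ (l + 1))) := by
  rcases X.eq_empty_or_nonempty with rfl | ⟨c₀, -⟩
  · have : wlen Cl sC Wl sW (l + 1) S ∅ = 0 := by
      unfold wlen
      refine Finset.sum_eq_zero fun w hw => ?_
      rw [Finset.mem_filter] at hw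
      by_contra hne
      obtain ⟨x, -, hx⟩ := Finset.exists_ne_zero_of_sum_ne_zero hne
      have := cube_mem_hull_of_bprod_apply_ne_zero (sW := sW) hCs l w hx
      rw [hw.2.1] at this
      exact Finset.notMem_empty _ this
    rw [this]; simp
  have hNc0 : 0 ≤ Nc := le_trans (Finset.sum_nonneg fun a _ => ite_nonneg (mul_nonneg (mul_nonneg (hcA _)
      (Real.exp_nonneg _)) (Nat.cast_nonneg _)) le_rfl) (hNc c₀)
  have hNw0 : 0 ≤ Nw := le_trans (Finset.sum_nonneg fun b _ => ite_nonneg (mul_nonneg (mul_nonneg (hwB _)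
      (Real.exp_nonneg _)) (Nat.cast_nonneg _)) le_rfl) (hNw c₀)
  have hG0 : ∀ w : Fin (l + 1) → A × B, 0 ≤ ∏ i, (cA (w i).1 * wB (w i).2) :=
    fun w => Finset.prod_nonneg fun i _ => mul_nonneg (hcA _) (hwB _)
  refine abs_wlen_le_of_majorant hCs hWs hs l S X (F := fun w => ε ^ m * ∏ i, (cA (w i).1 * wB (w i).2))
    (fun w => mul_nonneg (pow_nonneg hε0 _) (hG0 w)) (fun w hw => ?_)
    (mul_nonneg (pow_nonneg hε0 _) (mul_nonneg (Real.exp_nonneg _) (pow_nonneg (mul_nonneg hNc0 hNw0) _))) ?_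
  · -- ‖word‖ ≤ Π ‖C‖‖W‖ ≤ Π ε^{degC}c ε^{degW}w = ε^{Σ(degC+degW)}·Π c w ≤ ε^m·Π c w
    calc ‖bprod (letter Cl Wl) (l + 1) w‖ ≤ ∏ i, (‖Cl (w i).1‖ * ‖Wl (w i).2‖) := norm_bprod_le l w
      _ ≤ ∏ i, ((ε ^ degC (w i).1 * cA (w i).1) * (ε ^ degW (w i).2 * wB (w i).2)) :=
          Finset.prod_le_prod (fun i _ => mul_nonneg (norm_nonneg _) (norm_nonneg _))
            fun i _ => mul_le_mul (hCle _) (hWle _) (norm_nonneg _) (mul_nonneg (pow_nonneg hε0 _) (hcA _))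
      _ = ε ^ (∑ i, (degC (w i).1 + degW (w i).2)) * ∏ i, (cA (w i).1 * wB (w i).2) := by
          rw [← Finset.prod_pow_eq_pow_sum, ← Finset.prod_mul_distrib]
          exact Finset.prod_congr rfl fun i _ => by rw [pow_add]; ring
      _ ≤ ε ^ m * ∏ i, (cA (w i).1 * wB (w i).2) :=
          mul_le_mul_of_nonneg_right (pow_le_pow_of_le_one hε0 hε1 (hS w hw)) (hG0 w)
  · intro x _
    have hpull : ∀ w : Fin (l + 1) → A × B,
        (if hull sC sW (l + 1) w = X ∧ LinkedFrom sC sW {cube x} (l + 1) w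
          then ε ^ m * ∏ i, (cA (w i).1 * wB (w i).2) else 0) =
        ε ^ m * (if hull sC sW (l + 1) w = X ∧ LinkedFrom sC sW {cube x} (l + 1) w
          then ∏ i, (cA (w i).1 * wB (w i).2) else 0) := by
      intro w; split_ifs <;> simp
    rw [Finset.sum_congr rfl fun w _ => hpull w, ← Finset.mul_sum]
    exact mul_le_mul_of_nonneg_left (sum_hull_linkedFrom_le hcA hwB hκ hNc hNw (l + 1) (cube x) X) (pow_nonneg hε0 _)

/-! ## §2 The series over the length -/

omit [Fintype ι] [DecidableEq A] [DecidableEq B] in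
/-- **THE REMAINDER SERIES CONVERGES AND IS SMALL** — under the graded hypotheses of `abs_wlen_le_biGraded` and `N_c N_w < 1`,
the length series `W(X) = Σ_{l≥1}(1/2l)·wlen l S_l X` (gen 8's `Wprime`, with a remainder selection) is absolutely convergent
and `|W(X)| ≤ ε^m·(N_cN_w/(2(1 − N_cN_w)))·s·|X|·e^{−κ|X|}`. [cite: BalabanImbrieJaffe1988, p.293, p.294] -/
theorem abs_Wprime_le_biGraded
    (hCs : ∀ a x y, Cl a x y ≠ 0 → cube x ∈ sC a ∧ cube y ∈ sC a)
    (hWs : ∀ b x y, Wl b x y ≠ 0 → cube x ∈ sW b ∧ cube y ∈ sW b)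
    {s : ℕ} (hs : ∀ c : ι, (Finset.univ.filter fun x => cube x = c).card ≤ s)
    {κ : ℝ} (hκ : 0 ≤ κ) (degC : A → ℕ) (degW : B → ℕ) {ε : ℝ} (hε0 : 0 ≤ ε) (hε1 : ε ≤ 1)
    (cA : A → ℝ) (hcA : ∀ a, 0 ≤ cA a) (hCle : ∀ a, ‖Cl a‖ ≤ ε ^ degC a * cA a)
    (wB : B → ℝ) (hwB : ∀ b, 0 ≤ wB b) (hWle : ∀ b, ‖Wl b‖ ≤ ε ^ degW b * wB b) {Nc Nw : ℝ} (hNc0 : 0 ≤ Nc)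
    (hNw0 : 0 ≤ Nw)
    (hNc : ∀ c : ι, ∑ a, (if c ∈ sC a then cA a * Real.exp (κ * (sC a).card) * (sC a).card else 0) ≤ Nc)
    (hNw : ∀ c : ι, ∑ b, (if c ∈ sW b then wB b * Real.exp (κ * (sW b).card) * (sW b).card else 0) ≤ Nw)
    (hρ : Nc * Nw < 1)
    (S : (l : ℕ) → (Fin (l + 1) → A × B) → Prop) [∀ l, DecidablePred (S l)] {m : ℕ}
    (hS : ∀ l w, S l w → m ≤ ∑ i, (degC (w i).1 + degW (w i).2)) (X : Finset ι) :
    Summable (fun l : ℕ => 1 / (2 * ((l : ℝ) + 1)) * wlen Cl sC Wl sW (l + 1) (S l) X) ∧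
      |Wprime Cl sC Wl sW S X| ≤
        ε ^ m * (Nc * Nw / (2 * (1 - Nc * Nw))) * (s * X.card * Real.exp (-(κ * X.card))) := by
  set D : ℝ := s * X.card * Real.exp (-(κ * X.card)) with hD
  have hD0 : 0 ≤ D := by positivity
  set θ : ℝ := Nc * Nw with hθ
  have hθ0 : 0 ≤ θ := mul_nonneg hNc0 hNw0
  have h1θ : 0 < 1 - θ := by linarith
  -- termwise: |(1/2(l+1)) wlen| ≤ (D ε^m θ/2)·θ^l   (using 1/(l+1) ≤ 1)
  have hterm : ∀ l : ℕ, |1 / (2 * ((l : ℝ) + 1)) * wlen Cl sC Wl sW (l + 1) (S l) X| ≤ D * ε ^ m * θ / 2 * θ ^ l := by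
    intro l
    have h := abs_wlen_le_biGraded hCs hWs hs hκ degC degW hε0 hε1 cA hcA hCle wB hwB hWle hNc hNw l (S l) (hS l) X
    have hl : (0 : ℝ) < 2 * ((l : ℝ) + 1) := by positivity
    have hl1 : 1 / (2 * ((l : ℝ) + 1)) ≤ 1 / 2 :=
      one_div_le_one_div_of_le two_pos (by linarith [(Nat.cast_nonneg l : (0 : ℝ) ≤ l)])
    rw [abs_mul, abs_of_pos (one_div_pos.mpr hl)]
    have hX0 : 0 ≤ s * X.card * (ε ^ m * (Real.exp (-(κ * X.card)) * θ ^ (l + 1))) := by positivity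
    calc 1 / (2 * ((l : ℝ) + 1)) * |wlen Cl sC Wl sW (l + 1) (S l) X|
        ≤ 1 / 2 * (s * X.card * (ε ^ m * (Real.exp (-(κ * X.card)) * θ ^ (l + 1)))) :=
          mul_le_mul hl1 h (abs_nonneg _) (by norm_num)
      _ = D * ε ^ m * θ / 2 * θ ^ l := by simp only [hD]; ring
  have hgeom : Summable (fun l : ℕ => D * ε ^ m * θ / 2 * θ ^ l) := (summable_geometric_of_lt_one hθ0 hρ).mul_left _
  have hsum : Summable (fun l : ℕ => 1 / (2 * ((l : ℝ) + 1)) * wlen Cl sC Wl sW (l + 1) (S l) X) :=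
    Summable.of_norm_bounded hgeom (fun l => by rw [Real.norm_eq_abs]; exact hterm l)
  refine ⟨hsum, ?_⟩
  unfold Wprime
  calc |∑' l : ℕ, 1 / (2 * ((l : ℝ) + 1)) * wlen Cl sC Wl sW (l + 1) (S l) X|
      ≤ ∑' l : ℕ, |1 / (2 * ((l : ℝ) + 1)) * wlen Cl sC Wl sW (l + 1) (S l) X| := by
        have h := norm_tsum_le_tsum_norm hsum.norm
        simpa only [Real.norm_eq_abs] using h
    _ ≤ ∑' l : ℕ, D * ε ^ m * θ / 2 * θ ^ l := hsum.abs.tsum_le_tsum hterm hgeom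
    _ = D * ε ^ m * θ / 2 * (1 - θ)⁻¹ := by rw [tsum_mul_left, tsum_geometric_of_lt_one hθ0 hρ]
    _ = ε ^ m * (θ / (2 * (1 - θ))) * D := by
        field_simp

end Graded

/-! ## §3 The printed shape: `|W(X)| ≤ e^{−cr(e_j)|X|}` -/

section Printed

/- r16's `PolymerSys` carries its polymer type in `Type`; the cube type of this section is accordingly `ι₀ : Type`. -/
variable {ι₀ : Type} [DecidableEq ι₀]
variable {cube : T → ι₀} {Cl : A → Matrix T T ℝ} {sC : A → Finset ι₀} {Wl : B → Matrix T T ℝ} {sW : B → Finset ι₀}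

omit [Fintype ι] [DecidableEq ι] [Fintype A] [DecidableEq A] [Fintype B] [DecidableEq B] [Fintype T] [DecidableEq T]
  [DecidableEq ι₀] in
/-- the free `|X|` is absorbed by one unit of decay rate: `|X|·e^{−|X|} ≤ 1`. [folklore] -/
private theorem card_mul_exp_neg_le_one (X : Finset ι₀) : (X.card : ℝ) * Real.exp (-(X.card : ℝ)) ≤ 1 := by
  have h : (X.card : ℝ) ≤ Real.exp (X.card : ℝ) := by linarith [Real.add_one_le_exp (X.card : ℝ)]
  rw [Real.exp_neg, ← div_eq_mul_inv, div_le_one (Real.exp_pos _)]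
  exact h

omit [Fintype ι] [DecidableEq ι] [DecidableEq A] [DecidableEq B] in
/-- **THE PRINTED SHAPE OF THE REMAINDER BOUNDS** — *"|W^{(j)‴}(X)| ≦ e^{−cr(e_j)|X|}"* (p. 293), *"|W^{(j)(iv)}(X)| ≦ e^{−cr(e_j)|X|}"*
(p. 293), *"|W^{(j)(v)}(X)| ≦ e^{−cr(e_j)|X|}"* (p. 294), *"|W^{(k)(vi)}(X)| ≦ e^{−cr(e_k)|X|}"* (p. 295): for a remainder selection
(every selected word carries at least ONE small factor, total degree `≥ 1`), a small factor `ε` (print: `e^{−cr(e_j)}`), decay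
rate `κ ≥ c·r(e_j) + 1` and the constants hypothesis `ε·s·N_cN_w/(2(1−N_cN_w)) ≤ 1` (the one small factor absorbs the sites of a
cube and the series constant — generic-constant reading as G-C2-p36-03), the constructed `W` obeys, on the cube polymer system,
`|W(X)| ≤ e^{−cr(e_j)|X|}` for every cube set `X` — the (S3) shape of p36's knitting `BIJ88Ineq5714Proof.ineq5714_knit`.
[cite: BalabanImbrieJaffe1988, p.293, p.294] -/
theorem abs_Wprime_le_printed_remainder
    (hCs : ∀ a x y, Cl a x y ≠ 0 → cube x ∈ sC a ∧ cube y ∈ sC a)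
    (hWs : ∀ b x y, Wl b x y ≠ 0 → cube x ∈ sW b ∧ cube y ∈ sW b)
    {s : ℕ} (hs : ∀ cb : ι₀, (Finset.univ.filter fun x => cube x = cb).card ≤ s)
    {c rj κ : ℝ} (hcrj : 0 ≤ c * rj) (hκ : c * rj + 1 ≤ κ) (degC : A → ℕ) (degW : B → ℕ) {ε : ℝ} (hε0 : 0 ≤ ε)
    (hε1 : ε ≤ 1) (cA : A → ℝ) (hcA : ∀ a, 0 ≤ cA a) (hCle : ∀ a, ‖Cl a‖ ≤ ε ^ degC a * cA a)
    (wB : B → ℝ) (hwB : ∀ b, 0 ≤ wB b) (hWle : ∀ b, ‖Wl b‖ ≤ ε ^ degW b * wB b) {Nc Nw : ℝ} (hNc0 : 0 ≤ Nc)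
    (hNw0 : 0 ≤ Nw)
    (hNc : ∀ cb : ι₀, ∑ a, (if cb ∈ sC a then cA a * Real.exp (κ * (sC a).card) * (sC a).card else 0) ≤ Nc)
    (hNw : ∀ cb : ι₀, ∑ b, (if cb ∈ sW b then wB b * Real.exp (κ * (sW b).card) * (sW b).card else 0) ≤ Nw)
    (hρ : Nc * Nw < 1)
    (S : (l : ℕ) → (Fin (l + 1) → A × B) → Prop) [∀ l, DecidablePred (S l)]
    (hS : ∀ l w, S l w → 1 ≤ ∑ i, (degC (w i).1 + degW (w i).2))
    (hconst : ε * (s * (Nc * Nw / (2 * (1 - Nc * Nw)))) ≤ 1) (X : Finset ι₀) :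
    |Wprime Cl sC Wl sW S X| ≤ Real.exp (-(c * rj) * (cubePolymers ι₀).card X) := by
  have hκ0 : 0 ≤ κ := by linarith
  have h := (abs_Wprime_le_biGraded hCs hWs hs hκ0 degC degW hε0 hε1 cA hcA hCle wB hwB hWle hNc0 hNw0 hNc hNw hρ S
    hS X).2
  rw [pow_one] at h
  have hK0 : 0 ≤ Nc * Nw / (2 * (1 - Nc * Nw)) := by
    have : 0 < 1 - Nc * Nw := by linarith
    positivity
  -- e^{−κ|X|} ≤ e^{−|X|}·e^{−c r_j |X|}
  have hexp : Real.exp (-(κ * X.card)) ≤ Real.exp (-(X.card : ℝ)) * Real.exp (-(c * rj) * X.card) := by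
    rw [← Real.exp_add, Real.exp_le_exp]
    have hX : (0 : ℝ) ≤ X.card := Nat.cast_nonneg _
    nlinarith
  calc |Wprime Cl sC Wl sW S X| ≤ ε * (Nc * Nw / (2 * (1 - Nc * Nw))) * (s * X.card * Real.exp (-(κ * X.card))) := h
    _ ≤ ε * (Nc * Nw / (2 * (1 - Nc * Nw))) * (s * X.card * (Real.exp (-(X.card : ℝ)) * Real.exp (-(c * rj) * X.card))) :=
        mul_le_mul_of_nonneg_left (mul_le_mul_of_nonneg_left hexp (by positivity)) (mul_nonneg hε0 hK0)
    _ = (ε * (s * (Nc * Nw / (2 * (1 - Nc * Nw))))) * ((X.card : ℝ) * Real.exp (-(X.card : ℝ))) *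
          Real.exp (-(c * rj) * X.card) := by ring
    _ ≤ 1 * 1 * Real.exp (-(c * rj) * X.card) := by
        refine mul_le_mul_of_nonneg_right (mul_le_mul hconst (card_mul_exp_neg_le_one X) (by positivity) zero_le_one)
          (Real.exp_nonneg _)
    _ = Real.exp (-(c * rj) * (cubePolymers ι₀).card X) := by simp [cubePolymers]

end Printed

end Literature.MathematicalPhysics.QuantumFieldTheory.BalabanImbrieJaffe1984to88.BIJ88SmallLetterRemainders293
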